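import Summits.AtomisticToContinuum.HydrodynamicLimit.Theses.InformationPercolationEngine

/-!
# Negative-lane helper for crux `PercolationClosesChaos` (stmt-AtomisticToContinuum-14915, rev 4):
bounded label tests miss the flux moment (the tail gap of the window transfer)

Finite shadow behind finding F15 (d2) of the standing disproof record (`Cruxes/PercolationClosesChaos/Disproof.lean`,
cycle 4, §10) of the crux `PercolationClosesChaos : KickFairRelEquilibrium → SpectralContractionR → ContactChaos`
(route InformationPercolationEngine), concerning the transfer stub `stub_subMeanFreeTimeWindow : VBP → LMP → ContactChaos`
of the line `Sketch` (`Cruxes/PercolationClosesChaos/Lines/Sketch.lean`). Both hypotheses of that stub (velocity-blind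
placement, local Maxwellianity of the `r`-pool) are in-probability statements over BOUNDED continuous label tests `F`,
while the target's empirical collision functional `K_N` counts every collision and its references `A_r`, `B^Ψ_r` are
FLUX moments `∫∫ π|v − w| μ_r ⊗ μ_r` of the pool. The lemma below is the two-point reason why bounded-test convergence
does not control a flux moment: the laws `p_n = (1 − 1/(n+1)) δ₀ + (1/(n+1)) δ_{n+1}` on `ℝ` converge to their `δ₀`
values on every bounded test, yet `Σₐ Σ_b pₐ p_b |xₐ − x_b| → 2 ≠ 0`. So the transfer consumes a velocity-tail /
collision-count uniform-integrability input under the evolved law — the content of the route's support item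
`CollisionMomentBound` (#7a), importable by name as an antecedent. No statement of the route is asserted here,
positively or negatively.
-/

namespace Summit.AtomisticToContinuum.HydrodynamicLimit.Theorems.PercolationClosesChaos.Negative

open Filter Topology
open scoped BigOperators

/-- **Bounded tests miss the flux moment.** There are two-point probability laws `p_n` on points `x_n` of `ℝ`
(`p_n = (1 − 1/(n+1), 1/(n+1))` on `(0, n+1)`) such that `Σₐ pₐ F(xₐ) → F(0)` for EVERY bounded `F : ℝ → ℝ`
(continuity is not even needed), while the flux moment `Σₐ Σ_b pₐ p_b |xₐ − x_b|` tends to `2`, not to the flux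
moment `0` of the bounded-test limit `δ₀`. [folklore] -/
theorem boundedTests_miss_fluxMoment :
    ∃ (p : ℕ → Fin 2 → ℝ) (x : ℕ → Fin 2 → ℝ),
      (∀ n a, 0 ≤ p n a) ∧ (∀ n, ∑ a, p n a = 1) ∧
      (∀ F : ℝ → ℝ, (∃ C, ∀ v, |F v| ≤ C) →
        Tendsto (fun n => ∑ a, p n a * F (x n a)) atTop (𝓝 (F 0))) ∧
      Tendsto (fun n => ∑ a, ∑ b, p n a * p n b * |x n a - x n b|) atTop (𝓝 2) := by
  refine ⟨fun n => ![1 - 1 / ((n : ℝ) + 1), 1 / ((n : ℝ) + 1)], fun n => ![0, (n : ℝ) + 1], ?_, ?_, ?_, ?_⟩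
  · intro n a
    have h1 : (0 : ℝ) ≤ 1 / ((n : ℝ) + 1) := by positivity
    have h2 : 1 / ((n : ℝ) + 1) ≤ 1 := by
      rw [div_le_one (by positivity)]; linarith [n.cast_nonneg (α := ℝ)]
    fin_cases a
    · simp only [Fin.zero_eta, Matrix.cons_val_zero]
      linarith
    · simp only [Fin.mk_one, Matrix.cons_val_one]
      exact h1
  · intro n; simp [Fin.sum_univ_two]
  · intro F ⟨C, hC⟩
    have hlim0 : Tendsto (fun n : ℕ => 1 / ((n : ℝ) + 1)) atTop (𝓝 0) := tendsto_one_div_add_atTop_nhds_zero_nat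
    have hA : Tendsto (fun n : ℕ => (1 - 1 / ((n : ℝ) + 1)) * F 0) atTop (𝓝 ((1 - 0) * F 0)) :=
      (tendsto_const_nhds.sub hlim0).mul_const (F 0)
    rw [sub_zero, one_mul] at hA
    have hB : Tendsto (fun n : ℕ => 1 / ((n : ℝ) + 1) * F ((n : ℝ) + 1)) atTop (𝓝 0) := by
      apply squeeze_zero_norm (a := fun n : ℕ => C * (1 / ((n : ℝ) + 1)))
      · intro n
        rw [Real.norm_eq_abs, abs_mul, abs_of_nonneg (by positivity : (0:ℝ) ≤ 1 / ((n : ℝ) + 1))]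
        have := hC ((n : ℝ) + 1)
        have h0 : (0 : ℝ) ≤ 1 / ((n : ℝ) + 1) := by positivity
        nlinarith
      · simpa using hlim0.const_mul C
    have := hA.add hB
    simp only [add_zero] at this
    simpa [Fin.sum_univ_two] using this
  · have hlim0 : Tendsto (fun n : ℕ => 1 / ((n : ℝ) + 1)) atTop (𝓝 0) := tendsto_one_div_add_atTop_nhds_zero_nat
    have key : ∀ n : ℕ, (∑ a, ∑ b, (![1 - 1 / ((n : ℝ) + 1), 1 / ((n : ℝ) + 1)] : Fin 2 → ℝ) a *
        (![1 - 1 / ((n : ℝ) + 1), 1 / ((n : ℝ) + 1)] : Fin 2 → ℝ) b *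
        |(![0, (n : ℝ) + 1] : Fin 2 → ℝ) a - (![0, (n : ℝ) + 1] : Fin 2 → ℝ) b|) = 2 * (1 - 1 / ((n : ℝ) + 1)) := by
      intro n
      have hn : (0 : ℝ) < (n : ℝ) + 1 := by positivity
      simp only [Fin.sum_univ_two, Matrix.cons_val_zero, Matrix.cons_val_one, sub_self, abs_zero,
        mul_zero, zero_sub, abs_neg, sub_zero, zero_add, add_zero, abs_of_pos hn]
      field_simp
      ring
    simp_rw [key]
    have h2 : Tendsto (fun n : ℕ => 2 * (1 - 1 / ((n : ℝ) + 1))) atTop (𝓝 (2 * (1 - 0))) :=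
      (tendsto_const_nhds.sub hlim0).const_mul 2
    rw [sub_zero, mul_one] at h2
    exact h2

end Summit.AtomisticToContinuum.HydrodynamicLimit.Theorems.PercolationClosesChaos.Negative
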